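import Summits.PneNP.PneNP.Theorems.ResolutionCannotProvePrimality.Negative.CornerPrimesCells

/-!
# Corner primes II — peeling the multiplier array row by row
(negative-side support for crux `stmt-PneNP-16923`,
`PrimalityPlaces.ResolutionCannotProvePrimality`)

Second of three files.  With the cell rule of `CornerPrimesCells`, the rows of the array multiplier
of `bal n p` are peeled from the top: `topRowL` (row `n-1`: the corner cell at column `2n-2`, then
columns `2n-3 … n-1`, importing the vanishing output bits `n-1 … 2n-3`, `2n-1` of `p` as units),
`midRowL r` (rows `r = n-2, …, 2`, each fed by the sum/carry units produced by the row above),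
`row1L` (row `1`) and `finalL` (`x_0 = 0`, `PP 0 0 = 0` against the output bit `0` of the odd `p`,
the empty clause).  Every block is a `StepList` given the units it consumes, and the units it
produces are located by the `mem_…` lemmas; index bookkeeping between blocks is `omega`.
-/

set_option linter.dupNamespace false -- `Summit.PneNP.PneNP.…`: summit = sub-problem (D-0017)

open Literature.Computability.Complexity Literature.Computability.MetaComplexity

namespace Summit.PneNP.PneNP.Theorems.ResolutionCannotProvePrimality.Negative

/-! ### The top row `r = n-1` -/

section toprow
variable {n p : ℕ}

/-- `PP (n-1) (n-1) = 1` from the two balance units. -/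
def preL (n : ℕ) : List (Finset (Literal ℕ)) :=
  [ {(PPV n (n - 1) (n - 1), true), (YV n (n - 1), false)}, {(PPV n (n - 1) (n - 1), true)} ]

/-- cell `i` of the top row sits at column `n-1+j`, `j = n-1-i`; cell `0` is the special corner
cell. Each block first imports its sum/carry unit from the output axioms. -/
def topBlock (n i : ℕ) : List (Finset (Literal ℕ)) :=
  if i = 0 then
    {(CV n (n - 1) (n - 1 + 1), false)} ::
      topCellL (accV n (n - 1 - 1) (n - 1 + (n - 1))) (PPV n (n - 1) (n - 1))
        (cinV n (n - 1) (n - 1)) (CV n (n - 1 - 1) (n - 1 + 1)) (CV n (n - 1) (n - 1 - 1 + 1))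
  else
    {(SV n (n - 1) (n - 1 + (n - 1 - i)), false)} ::
      cellL (accV n (n - 1 - 1) (n - 1 + (n - 1 - i))) (PPV n (n - 1) (n - 1 - i))
        (cinV n (n - 1) (n - 1 - i)) (SV n (n - 1 - 1) (n - 1 - 1 + (n - 1 - (i - 1))))
        (if i = n - 1 then cinV n (n - 1) (n - 1 - i) else CV n (n - 1) (n - 1 - (i + 1) + 1))

/-- the step list of the top row. -/
def topRowL (n : ℕ) : List (Finset (Literal ℕ)) :=
  preL n ++ (List.range n).flatMap (topBlock n)

/-- `preL` is a step list over the axioms. -/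
theorem preL_stepList (hn : 1 ≤ n) {A : Set (Finset (Literal ℕ))}
    (hax : ∀ cl ∈ bal n p, cl.toFinset ∈ A) : StepList A (preL n) := by
  have hx : ({(XV (n - 1), true)} : Finset (Literal ℕ)) ∈ A := by simpa using hax _ xunit_mem
  have hy : ({(YV n (n - 1), true)} : Finset (Literal ℕ)) ∈ A := by simpa using hax _ yunit_mem
  have h3 : ({(PPV n (n - 1) (n - 1), true), (XV (n - 1), false), (YV n (n - 1), false)} :
      Finset (Literal ℕ)) ∈ A := by
    simpa using hax [(PPV n (n - 1) (n - 1), true), (XV (n - 1), false), (YV n (n - 1), false)]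
      (and_mem (i := n - 1) (j := n - 1) (by omega) (by omega) (by simp [andCl]))
  unfold preL
  refine stepList_cons.2 ⟨step_res (XV (n - 1))
    hx h3 (by simp) (by simp)
    (by simp) (by simp [Finset.insert_subset_iff]), ?_⟩
  refine stepList_cons.2 ⟨step_res (YV n (n - 1))
    (D := {(YV n (n - 1), true)})
    (E := {(PPV n (n - 1) (n - 1), true), (YV n (n - 1), false)})
    (by simp [hy]) (by simp) (by simp) (by simp)
    (by simp) (by simp [Finset.insert_subset_iff]), ?_⟩
  exact stepList_nil _

/-- the corner cell block is a step list (needs bit `2n-1` of `p` to vanish). -/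
theorem topBlock_zero_stepList (hn : 3 ≤ n)
    (hbits : ∀ j, n - 1 ≤ j → j ≠ 2 * n - 2 → Nat.testBit p j = false)
    {A : Set (Finset (Literal ℕ))} (hax : ∀ cl ∈ bal n p, cl.toFinset ∈ A)
    (hb : ({(PPV n (n - 1) (n - 1), true)} : Finset (Literal ℕ)) ∈ A) :
    StepList A (topBlock n 0) := by
  unfold topBlock
  rw [if_pos rfl]
  refine stepList_cons.2 ⟨step_eq (hax _ (out_mem (k := 2 * n - 1) (by omega))) ?_, ?_⟩
  · rw [accV_topcarry (by omega), hbits (2 * n - 1) (by omega) (by omega)]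
    simp
  refine topCellL_stepList (m := CV n (n - 1) (n - 1 + 1)) ?_ (Set.mem_insert _ _)
    (Set.mem_insert_of_mem _ hb) ?_ ?_
  · intro cl hcl
    exact Set.mem_insert_of_mem _
      (hax _ (maj_mem (i := n - 1) (j := n - 1) (by omega) (by omega) (by omega) hcl))
  · rw [accV_carry (by omega) (by omega)]
    congr 1; omega
  · rw [cinV_pos (by omega)]
    congr 1; omega

/-- the other top-row blocks are step lists (need bits `n-1 … 2n-3` of `p` to vanish). -/
theorem topBlock_succ_stepList (hn : 3 ≤ n) {i : ℕ} (hi1 : 1 ≤ i) (hin : i < n)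
    (hbits : ∀ j, n - 1 ≤ j → j ≠ 2 * n - 2 → Nat.testBit p j = false)
    {A : Set (Finset (Literal ℕ))} (hax : ∀ cl ∈ bal n p, cl.toFinset ∈ A)
    (hm : ({(CV n (n - 1) (n - 1 - i + 1), false)} : Finset (Literal ℕ)) ∈ A) :
    StepList A (topBlock n i) := by
  unfold topBlock
  rw [if_neg (by omega)]
  refine stepList_cons.2 ⟨step_eq (hax _ (out_mem (k := n - 1 + (n - 1 - i)) (by omega))) ?_, ?_⟩
  · rw [accV_top (by omega) (by omega), hbits (n - 1 + (n - 1 - i)) (by omega) (by omega)]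
    simp
  refine cellL_stepList (s := SV n (n - 1) (n - 1 + (n - 1 - i)))
    (m := CV n (n - 1) (n - 1 - i + 1)) ?_ ?_
    (Set.mem_insert _ _)
    (Set.mem_insert_of_mem _ hm) ?_ ?_
  · intro cl hcl
    exact Set.mem_insert_of_mem _
      (hax _ (xor_mem (i := n - 1) (j := n - 1 - i) (by omega) (by omega) (by omega) hcl))
  · intro cl hcl
    exact Set.mem_insert_of_mem _
      (hax _ (maj_mem (i := n - 1) (j := n - 1 - i) (by omega) (by omega) (by omega) hcl))
  · rw [accV_sum (by omega) (by omega) (by omega)]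
    congr 1; omega
  · split_ifs with h
    · rfl
    · rw [cinV_pos (by omega)]
      congr 1; omega

/-- the carry unit handed from top cell `i` to top cell `i+1`. -/
theorem mem_topBlock_c (hn : 3 ≤ n) {i : ℕ} (hin : i + 1 < n) :
    ({(CV n (n - 1) (n - 1 - (i + 1) + 1), false)} : Finset (Literal ℕ)) ∈ topBlock n i := by
  unfold topBlock
  split_ifs with h0 h1
  · subst h0
    have e : n - 1 - (0 + 1) + 1 = n - 1 - 1 + 1 := by omega
    rw [e]; simp [topCellL]
  · omega
  · simp [cellL]

/-- the top row is a step list over the axioms. -/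
theorem topRowL_stepList (hn : 3 ≤ n)
    (hbits : ∀ j, n - 1 ≤ j → j ≠ 2 * n - 2 → Nat.testBit p j = false)
    {A : Set (Finset (Literal ℕ))} (hax : ∀ cl ∈ bal n p, cl.toFinset ∈ A) :
    StepList A (topRowL n) := by
  refine StepList.append (preL_stepList (by omega) hax) (stepList_flatMap_range fun i hi => ?_)
  have hax' : ∀ cl ∈ bal n p,
      cl.toFinset ∈ A ∪ {C | C ∈ preL n} ∪ {C | ∃ i' < i, C ∈ topBlock n i'} :=
    fun cl h => Or.inl (Or.inl (hax cl h))
  rcases Nat.eq_zero_or_pos i with rfl | hi1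
  · exact topBlock_zero_stepList hn hbits hax' (Or.inl (Or.inr (by simp [preL])))
  · refine topBlock_succ_stepList hn hi1 hi hbits hax' (Or.inr ⟨i - 1, by omega, ?_⟩)
    have e : n - 1 - i + 1 = n - 1 - (i - 1 + 1) + 1 := by omega
    rw [e]
    exact mem_topBlock_c hn (by omega)

/-- outputs of the top row: the top carry of row `n-2` … -/
theorem mem_topRowL_carry (hn : 1 ≤ n) :
    ({(CV n (n - 1 - 1) (n - 1 + 1), false)} : Finset (Literal ℕ)) ∈ topRowL n := by
  refine List.mem_append.2 (Or.inr (List.mem_flatMap.2 ⟨0, List.mem_range.2 hn, ?_⟩))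
  unfold topBlock
  rw [if_pos rfl]
  simp [topCellL]

/-- … and its sum bits at the columns `n-1 … 2n-3`. -/
theorem mem_topRowL_sum {i : ℕ} (hi1 : 1 ≤ i) (hin : i < n) :
    ({(SV n (n - 1 - 1) (n - 1 - 1 + (n - 1 - (i - 1))), false)} : Finset (Literal ℕ)) ∈
      topRowL n := by
  refine List.mem_append.2 (Or.inr (List.mem_flatMap.2 ⟨i, List.mem_range.2 hin, ?_⟩))
  unfold topBlock
  rw [if_neg (by omega)]
  simp [cellL]

end toprow

/-! ### The middle rows `r = n-2, …, 2` -/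

section midrows
variable {n p : ℕ}

/-- cell `i` of row `r` sits at column `r+j`, `j = n-1-i` (`0 ≤ i ≤ r`). -/
def midBlock (n r i : ℕ) : List (Finset (Literal ℕ)) :=
  cellL (accV n (r - 1) (r + (n - 1 - i))) (PPV n r (n - 1 - i)) (cinV n r (n - 1 - i))
    (if i = 0 then CV n (r - 1) (n - 1 + 1) else SV n (r - 1) (r - 1 + (n - 1 - (i - 1))))
    (CV n r (n - 1 - (i + 1) + 1))

/-- the step list of a middle row `r`. -/
def midRowL (n r : ℕ) : List (Finset (Literal ℕ)) :=
  (List.range (r + 1)).flatMap (midBlock n r)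

/-- a middle cell block is a step list, given its sum and carry-out units. -/
theorem midBlock_stepList {r : ℕ} (hr : 2 ≤ r) (hrn : r + 2 ≤ n) {i : ℕ} (hir : i ≤ r)
    {A : Set (Finset (Literal ℕ))} (hax : ∀ cl ∈ bal n p, cl.toFinset ∈ A)
    (hs : ({(SV n r (r + (n - 1 - i)), false)} : Finset (Literal ℕ)) ∈ A)
    (hm : ({(CV n r (n - 1 - i + 1), false)} : Finset (Literal ℕ)) ∈ A) :
    StepList A (midBlock n r i) := by
  unfold midBlock
  refine cellL_stepList (s := SV n r (r + (n - 1 - i))) (m := CV n r (n - 1 - i + 1))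
    ?_ ?_ hs hm ?_ ?_
  · intro cl hcl
    exact hax _ (xor_mem (i := r) (j := n - 1 - i) (by omega) (by omega) (by omega) hcl)
  · intro cl hcl
    exact hax _ (maj_mem (i := r) (j := n - 1 - i) (by omega) (by omega) (by omega) hcl)
  · split_ifs with h0
    · subst h0
      rw [accV_carry (by omega) (by omega)]
      congr 1; omega
    · rw [accV_sum (by omega) (by omega) (by omega)]
      congr 1; omega
  · rw [cinV_pos (by omega)]
    congr 1; omega

/-- the carry unit handed from cell `i` to cell `i+1` of a middle row. -/
theorem mem_midBlock_c {r i : ℕ} :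
    ({(CV n r (n - 1 - (i + 1) + 1), false)} : Finset (Literal ℕ)) ∈ midBlock n r i := by
  simp [midBlock, cellL]

/-- a middle row is a step list, given the units produced by the row above. -/
theorem midRowL_stepList {r : ℕ} (hr : 2 ≤ r) (hrn : r + 2 ≤ n)
    {A : Set (Finset (Literal ℕ))} (hax : ∀ cl ∈ bal n p, cl.toFinset ∈ A)
    (hs : ∀ i ≤ r, ({(SV n r (r + (n - 1 - i)), false)} : Finset (Literal ℕ)) ∈ A)
    (hm : ({(CV n r (n - 1 + 1), false)} : Finset (Literal ℕ)) ∈ A) :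
    StepList A (midRowL n r) := by
  refine stepList_flatMap_range fun i hi => ?_
  have hax' : ∀ cl ∈ bal n p, cl.toFinset ∈ A ∪ {C | ∃ i' < i, C ∈ midBlock n r i'} :=
    fun cl h => Or.inl (hax cl h)
  refine midBlock_stepList hr hrn (by omega) hax' (Or.inl (hs i (by omega))) ?_
  rcases Nat.eq_zero_or_pos i with rfl | hi1
  · exact Or.inl hm
  · refine Or.inr ⟨i - 1, by omega, ?_⟩
    have e : n - 1 - i + 1 = n - 1 - (i - 1 + 1) + 1 := by omega
    rw [e]
    exact mem_midBlock_c

/-- outputs of a middle row: the top carry of the row below … -/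
theorem mem_midRowL_carry {r : ℕ} :
    ({(CV n (r - 1) (n - 1 + 1), false)} : Finset (Literal ℕ)) ∈ midRowL n r := by
  refine List.mem_flatMap.2 ⟨0, List.mem_range.2 (by omega), ?_⟩
  simp [midBlock, cellL]

/-- … and its sum bits. -/
theorem mem_midRowL_sum {r i : ℕ} (hi1 : 1 ≤ i) (hir : i ≤ r) :
    ({(SV n (r - 1) (r - 1 + (n - 1 - (i - 1))), false)} : Finset (Literal ℕ)) ∈ midRowL n r := by
  refine List.mem_flatMap.2 ⟨i, List.mem_range.2 (by omega), ?_⟩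
  unfold midBlock
  rw [if_neg (by omega)]
  simp [cellL]

end midrows

/-! ### Row `1` and the final contradiction -/

section bottom
variable {n p : ℕ}

/-- the two cells of row `1` above column `n-1`: columns `n` (`j = n-1`) and `n-1` (`j = n-2`). -/
def row1L (n : ℕ) : List (Finset (Literal ℕ)) :=
  cellL (accV n (1 - 1) (1 + (n - 1))) (PPV n 1 (n - 1)) (cinV n 1 (n - 1)) (Z0V n)
      (CV n 1 (n - 2 + 1)) ++
    cellL (accV n (1 - 1) (1 + (n - 2))) (PPV n 1 (n - 2)) (cinV n 1 (n - 2)) (PPV n 0 (n - 1))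
      (cinV n 1 (n - 2))

/-- row `1` is a step list, given the units produced by row `2`. -/
theorem row1L_stepList (hn : 3 ≤ n) {A : Set (Finset (Literal ℕ))}
    (hax : ∀ cl ∈ bal n p, cl.toFinset ∈ A)
    (hsA : ({(SV n 1 (1 + (n - 1)), false)} : Finset (Literal ℕ)) ∈ A)
    (hsB : ({(SV n 1 (1 + (n - 2)), false)} : Finset (Literal ℕ)) ∈ A)
    (hm : ({(CV n 1 (n - 1 + 1), false)} : Finset (Literal ℕ)) ∈ A) : StepList A (row1L n) := by
  refine StepList.append ?_ ?_
  · refine cellL_stepList (s := SV n 1 (1 + (n - 1))) (m := CV n 1 (n - 1 + 1)) ?_ ?_ hsA hm ?_ ?_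
    · intro cl hcl
      exact hax _ (xor_mem (i := 1) (j := n - 1) (by omega) (by omega) (by omega) hcl)
    · intro cl hcl
      exact hax _ (maj_mem (i := 1) (j := n - 1) (by omega) (by omega) (by omega) hcl)
    · show Z0V n = accV n 0 (1 + (n - 1))
      rw [accV_row0_top (by omega)]
    · rw [cinV_pos (by omega)]
      congr 1; omega
  · refine cellL_stepList (s := SV n 1 (1 + (n - 2))) (m := CV n 1 (n - 2 + 1)) ?_ ?_
      (Or.inl hsB) (Or.inr (by simp [cellL])) ?_ rfl
    · intro cl hcl
      exact Or.inl (hax _ (xor_mem (i := 1) (j := n - 2) (by omega) (by omega) (by omega) hcl))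
    · intro cl hcl
      exact Or.inl (hax _ (maj_mem (i := 1) (j := n - 2) (by omega) (by omega) (by omega) hcl))
    · show PPV n 0 (n - 1) = accV n 0 (1 + (n - 2))
      rw [accV_row0 (by omega)]
      congr 1; omega

/-- output of row `1`: `PP 0 (n-1) = 0`. -/
theorem mem_row1L_pp : ({(PPV n 0 (n - 1), false)} : Finset (Literal ℕ)) ∈ row1L n := by
  simp [row1L, cellL]

/-- `x_0 = 0`, hence `PP 0 0 = 0`, against the output bit `0` of the odd number `p`. -/
def finalL (n : ℕ) : List (Finset (Literal ℕ)) :=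
  [ {(PPV n 0 (n - 1), true), (XV 0, false)}, {(XV 0, false)}, {(PPV n 0 0, false)},
    {(PPV n 0 0, true)}, ∅ ]

/-- the final block is a step list ending in `∅`. -/
theorem finalL_stepList (hn : 2 ≤ n) (hbit0 : Nat.testBit p 0 = true)
    {A : Set (Finset (Literal ℕ))} (hax : ∀ cl ∈ bal n p, cl.toFinset ∈ A)
    (hpp : ({(PPV n 0 (n - 1), false)} : Finset (Literal ℕ)) ∈ A) : StepList A (finalL n) := by
  have hy : ({(YV n (n - 1), true)} : Finset (Literal ℕ)) ∈ A := by simpa using hax _ yunit_mem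
  have h3 : ({(PPV n 0 (n - 1), true), (XV 0, false), (YV n (n - 1), false)} :
      Finset (Literal ℕ)) ∈ A := by
    simpa using hax [(PPV n 0 (n - 1), true), (XV 0, false), (YV n (n - 1), false)]
      (and_mem (i := 0) (j := n - 1) (by omega) (by omega) (by simp [andCl]))
  have h1 : ({(PPV n 0 0, false), (XV 0, true)} : Finset (Literal ℕ)) ∈ A := by
    simpa using hax [(PPV n 0 0, false), (XV 0, true)]
      (and_mem (i := 0) (j := 0) (by omega) (by omega) (by simp [andCl]))
  have h0 : ({(PPV n 0 0, true)} : Finset (Literal ℕ)) ∈ A := by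
    have := hax _ (out_mem (k := 0) (by omega))
    rwa [accV_zero hn, hbit0, show [(PPV n 0 0, true)].toFinset = {(PPV n 0 0, true)} by simp]
      at this
  unfold finalL
  refine stepList_cons.2 ⟨step_res (YV n (n - 1))
    hy h3 (by simp) (by simp)
    (by simp) (by simp [Finset.insert_subset_iff]), ?_⟩
  refine stepList_cons.2 ⟨step_res (PPV n 0 (n - 1))
    (D := {(PPV n 0 (n - 1), true), (XV 0, false)})
    (E := {(PPV n 0 (n - 1), false)})
    (by simp) (by simp [hpp]) (by simp) (by simp)
    (by simp) (by simp), ?_⟩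
  refine stepList_cons.2 ⟨step_res (XV 0)
    (D := {(PPV n 0 0, false), (XV 0, true)})
    (E := {(XV 0, false)})
    (by simp [h1]) (by simp) (by simp) (by simp)
    (by simp [Finset.insert_subset_iff]) (by simp), ?_⟩
  refine stepList_cons.2 ⟨step_eq (D := {(PPV n 0 0, true)}) (by simp [h0]) rfl, ?_⟩
  refine stepList_cons.2 ⟨step_res (PPV n 0 0)
    (D := {(PPV n 0 0, true)})
    (E := {(PPV n 0 0, false)})
    (by simp) (by simp) (by simp) (by simp)
    (by simp) (by simp), ?_⟩
  exact stepList_nil _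

end bottom

end Summit.PneNP.PneNP.Theorems.ResolutionCannotProvePrimality.Negative
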